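import Summits.NavierStokesRegularity.NavierStokesRegularity.Theorems.PalasekTowerBreakdownEpisodeBaseAgmonExplicit
import Literature.Analysis.FluidPDE.NSRobustnessOfRegularity

/-!
# The explicit Agmon constant `√2/π` in the currency of the `H²` robustness door: `‖w(x)‖ ≤ (√2/π)(∫|∇w|²_F · ∫‖Δw‖²)^{1/4}`

Cell `ns-blowup`, seat `ns-palasek-20303-p1` (g0, LEAD prover of the crux `EpisodeBaseT` = item
stmt-NavierStokesRegularity-20303, line `straindoor` re-pointed at `TowerRates.tuned`; `--supports` that item).
LABEL: E–C analysis (KERNEL: theorems only; no definition, no named fact, no `sorry`; register-free).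

WHY. The `H²`-currency certificate letter of the crux (`StrainDoor.CertificateDataH2`,
`FluidComputer/PalasekTowerStrainDoorAtH2`, p536855) carries the tree's Agmon constant `agmonConst`
(`Literature/…/NSStrongSpeedBound`) in three fields; `agmonConst` is built from Mathlib's Sobolev constant
`SNormLESNormFDerivOfEqConst` (a chosen linear equivalence) and has NO provable numerical value, so a validated
computation cannot discharge those fields. Seat 19179-p2 (g6) proved Agmon's inequality with the EXPLICIT constant
`√2/π` (`…Theorems.AgmonExplicit.norm_le_agmon_explicit`), but for fields of the class `IsSmoothL2Field` (all
derivatives bounded AND in `L²`) and in the basis quantities `∑ᵢ‖∂ᵢv‖₂²`, `∑ᵢⱼ‖∂ᵢ∂ⱼv‖₂²`. The robustness vein of the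
tree (`NSRobustnessOfRegularity`, `…H2`, `…SupNorm`: `norm_le_agmonConst_mul_rpow`) speaks instead of a `C^∞` field
with derivatives in `L²` (NO boundedness hypothesis) and of `(∫|∇w|²_F)(∫‖Δw‖²)`. THIS FILE closes that gap:

* §1 `sobolev_clm_comp`, `sobolev_fderiv_apply`, `integrable_sq_norm_of_sobolev_zero` — closure of "smooth with
  every derivative in `L²`" under continuous linear maps and directional slices (no boundedness needed);
* §2 `norm_le_agmon_explicit_real'`, `norm_le_agmon_explicit'` — g6's real and vector explicit Agmon inequalities
  re-proved under the WEAK hypotheses `ContDiff ℝ ∞ v ∧ ∀ n, ∫⁻‖Dⁿv‖ₑ² < ∞` (g6's complex-scalar theorem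
  `norm_le_agmon_explicit_complex` already has exactly these hypotheses; only the two reductions used
  `IsSmoothL2Field`, for convenience);
* §3 `sum_sum_norm_fderiv_fderiv_eq_levelSq_two` (basis independence of `∑ᵢⱼ‖D²w(bᵢ,bⱼ)‖²`, via `flip`, no
  symmetry of second derivatives used) and **`norm_le_explicitAgmon_mul_rpow`** — the literal twin of
  `Literature.Analysis.FluidPDE.norm_le_agmonConst_mul_rpow` with `agmonConst` replaced by `Real.sqrt 2 / Real.pi`
  (hypothesis `∀ n` in place of `n ≤ 3`, which every caller in the robustness vein holds: Tao's class
  `HasBoundedSobolevNormsOn` is all-orders).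

USE. Re-threading `classicalNS_norm_sub_le_strain_window_half_R3` (lit g17, p534557) and its `H2`/`SupNorm`
parents with `A := √2/π` is now a substitution of this lemma for `norm_le_agmonConst_mul_rpow`; the three
`agmonConst` fields of `CertificateDataH2` then become numerals (`√2/π < 0.4502`). WHAT THIS IS NOT: not
Navier–Stokes evidence — a Sobolev inequality; no flow, run, design, certificate or blow-up is exhibited.

References: S. Agmon, *Lectures on Elliptic Boundary Value Problems* (1965) §13; J. C. Robinson, J. L. Rodrigo,
W. Sadowski, *The three-dimensional Navier–Stokes equations*, CUP 2016, Thm. 1.20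
[cite: RobinsonRodrigoSadowski2016, Thm. 1.20]; E. M. Stein, G. Weiss, Princeton 1971, Ch. I Thm. 2.3
[cite: SteinWeiss1971, Ch. I Thm. 2.3].
-/

noncomputable section

set_option linter.dupNamespace false

open MeasureTheory Filter Function Set Metric
open Literature.Analysis Literature.Analysis.FunctionSpaces Literature.Analysis.FluidPDE
open scoped ENNReal NNReal RealInnerProductSpace Topology ContDiff Laplacian

namespace Summit.NavierStokesRegularity.NavierStokesRegularity.Theorems.AgmonExplicitSobolev

open Summit.NavierStokesRegularity.NavierStokesRegularity.Theorems.AgmonExplicit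

variable {E : Type*} [NormedAddCommGroup E] [InnerProductSpace ℝ E] [FiniteDimensional ℝ E]
  [MeasurableSpace E] [BorelSpace E]
variable {F : Type*} [NormedAddCommGroup F] [NormedSpace ℝ F]

/-! ## §1 "Smooth with every derivative in `L²`" is stable under linear maps and slices -/

/-- `L ∘ v` has every derivative in `L²` when `v` does (`‖Dⁿ(L∘v)‖ ≤ ‖L‖‖Dⁿv‖`). [cite: SteinWeiss1971, Ch. I Thm. 2.3] -/
theorem sobolev_clm_comp {G : Type*} [NormedAddCommGroup G] [NormedSpace ℝ G] {v : E → F}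
    (hv : ContDiff ℝ ∞ v) (hn : ∀ n : ℕ, ∫⁻ x, ‖iteratedFDeriv ℝ n v x‖ₑ ^ 2 < ⊤) (L : F →L[ℝ] G)
    (n : ℕ) : ∫⁻ x, ‖iteratedFDeriv ℝ n (fun y => L (v y)) x‖ₑ ^ 2 < ⊤ := by
  have hpt : ∀ x, ‖iteratedFDeriv ℝ n (fun y => L (v y)) x‖ ≤ ‖(‖L‖ • iteratedFDeriv ℝ n v x)‖ := by
    intro x
    rw [norm_smul, Real.norm_of_nonneg (norm_nonneg _)]
    exact L.norm_iteratedFDeriv_comp_left hv.contDiffAt (by exact_mod_cast le_top)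
  refine lintegral_enorm_sq_lt_top_of_norm_le hpt ?_
  have h : ∫⁻ x, ‖(‖L‖ • iteratedFDeriv ℝ n v x)‖ₑ ^ 2 =
      ‖(‖L‖)‖ₑ ^ 2 * ∫⁻ x, ‖iteratedFDeriv ℝ n v x‖ₑ ^ 2 := by
    rw [← lintegral_const_mul' _ _ (ENNReal.pow_ne_top enorm_ne_top)]
    exact lintegral_congr fun x => by rw [enorm_smul, mul_pow]
  rw [h]
  exact ENNReal.mul_lt_top ((ENNReal.pow_ne_top enorm_ne_top).lt_top) (hn n)

/-- A directional slice `y ↦ Dv(y)·u` has every derivative in `L²` when `v` does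
(`‖Dⁿ(Dv·u)‖ ≤ ‖u‖‖Dⁿ⁺¹v‖`). [cite: SteinWeiss1971, Ch. I Thm. 2.3] -/
theorem sobolev_fderiv_apply {v : E → F} (hv : ContDiff ℝ ∞ v)
    (hn : ∀ n : ℕ, ∫⁻ x, ‖iteratedFDeriv ℝ n v x‖ₑ ^ 2 < ⊤) (u : E) (n : ℕ) :
    ∫⁻ x, ‖iteratedFDeriv ℝ n (fun y => fderiv ℝ v y u) x‖ₑ ^ 2 < ⊤ := by
  have hd : ContDiff ℝ ∞ (fderiv ℝ v) := hv.fderiv_right (m := ∞) (by simp)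
  have hpt : ∀ x, ‖iteratedFDeriv ℝ n (fun y => fderiv ℝ v y u) x‖ ≤
      ‖(‖u‖ • iteratedFDeriv ℝ (n + 1) v x)‖ := by
    intro x
    rw [norm_smul, Real.norm_of_nonneg (norm_nonneg _), ← norm_iteratedFDeriv_fderiv]
    exact norm_iteratedFDeriv_clm_apply_const hd.contDiffAt (by exact_mod_cast le_top)
  refine lintegral_enorm_sq_lt_top_of_norm_le hpt ?_
  have h : ∫⁻ x, ‖(‖u‖ • iteratedFDeriv ℝ (n + 1) v x)‖ₑ ^ 2 =
      ‖(‖u‖)‖ₑ ^ 2 * ∫⁻ x, ‖iteratedFDeriv ℝ (n + 1) v x‖ₑ ^ 2 := by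
    rw [← lintegral_const_mul' _ _ (ENNReal.pow_ne_top enorm_ne_top)]
    exact lintegral_congr fun x => by rw [enorm_smul, mul_pow]
  rw [h]
  exact ENNReal.mul_lt_top ((ENNReal.pow_ne_top enorm_ne_top).lt_top) (hn (n + 1))

/-- A continuous field with `∫⁻‖D⁰v‖ₑ² < ∞` has `‖v‖²` integrable. [cite: SteinWeiss1971, Ch. I Thm. 2.3] -/
theorem integrable_sq_norm_of_sobolev_zero {v : E → F} (hv : ContDiff ℝ ∞ v)
    (h0 : ∫⁻ x, ‖iteratedFDeriv ℝ 0 v x‖ₑ ^ 2 < ⊤) : Integrable (fun x => ‖v x‖ ^ 2) := by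
  refine integrable_sq_norm_of_lintegral_lt_top hv.continuous ?_
  exact lintegral_enorm_sq_lt_top_of_norm_le (fun x => by rw [norm_iteratedFDeriv_zero]) h0

omit [FiniteDimensional ℝ E] [MeasurableSpace E] [BorelSpace E] in
/-- Directional slices of a `C^∞` field are `C^∞`. [cite: SteinWeiss1971, Ch. I Thm. 2.3] -/
theorem contDiff_fderiv_apply {v : E → F} (hv : ContDiff ℝ ∞ v) (u : E) :
    ContDiff ℝ ∞ (fun y => fderiv ℝ v y u) :=
  (hv.fderiv_right (m := ∞) (by simp)).clm_apply contDiff_const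

/-! ## §2 The explicit Agmon inequalities under the weak hypotheses -/

/-- **Agmon's inequality with the explicit constant `√2/π`, real scalars, weak hypotheses**: for
`φ : E → ℝ` of class `C^∞` with every derivative in `L²` on a three-dimensional real inner product space,
`|φ(x)| ≤ (√2/π) · (∑ᵢ ‖∂ᵢφ‖₂²)^{1/4} · (∑ᵢⱼ ‖∂ᵢ∂ⱼφ‖₂²)^{1/4}` (g6's `norm_le_agmon_explicit_real` without the
boundedness half of `IsSmoothL2Field`). [cite: SteinWeiss1971, Ch. I Thm. 2.3] -/
theorem norm_le_agmon_explicit_real' (h3 : Module.finrank ℝ E = 3) {φ : E → ℝ} (hφ : ContDiff ℝ ∞ φ)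
    (hn : ∀ n : ℕ, ∫⁻ x, ‖iteratedFDeriv ℝ n φ x‖ₑ ^ 2 < ⊤) (x : E) :
    ‖φ x‖ ≤ Real.sqrt 2 / Real.pi *
      Real.sqrt (Real.sqrt (∑ i, ∫ y, ‖fderiv ℝ φ y (stdOrthonormalBasis ℝ E i)‖ ^ 2) *
        Real.sqrt (∑ i, ∑ j, ∫ y, ‖fderiv ℝ (fun z => fderiv ℝ φ z (stdOrthonormalBasis ℝ E j)) y
          (stdOrthonormalBasis ℝ E i)‖ ^ 2)) := by
  -- complexify
  have hFc : ContDiff ℝ ∞ (fun y => Complex.ofRealCLM (φ y)) := Complex.ofRealCLM.contDiff.comp hφ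
  have h := norm_le_agmon_explicit_complex h3 hFc (sobolev_clm_comp hφ hn Complex.ofRealCLM) x
  have hφd : Differentiable ℝ φ := hφ.differentiable (by simp)
  -- first and second derivatives of the complexification
  have hd1 : ∀ (v : E) (y : E), fderiv ℝ (fun z => Complex.ofRealCLM (φ z)) y v =
      Complex.ofRealCLM (fderiv ℝ φ y v) := fun v y => fderiv_clm_comp_apply Complex.ofRealCLM hφd y v
  have hd1' : ∀ v : E, (fun y => fderiv ℝ (fun z => Complex.ofRealCLM (φ z)) y v) =
      fun y => Complex.ofRealCLM (fderiv ℝ φ y v) := fun v => funext (hd1 v)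
  have hψd : ∀ v : E, Differentiable ℝ (fun y => fderiv ℝ φ y v) := fun v =>
    (contDiff_fderiv_apply hφ v).differentiable (by simp)
  have hd2 : ∀ (u v : E) (y : E), fderiv ℝ (fun z => fderiv ℝ (fun z' => Complex.ofRealCLM (φ z')) z v) y u =
      Complex.ofRealCLM (fderiv ℝ (fun z => fderiv ℝ φ z v) y u) := by
    intro u v y; rw [hd1' v]; exact fderiv_clm_comp_apply Complex.ofRealCLM (hψd v) y u
  have e0 : ‖Complex.ofRealCLM (φ x)‖ = ‖φ x‖ := by simp
  have e1 : ∀ v : E, (∫ y, ‖fderiv ℝ (fun z => Complex.ofRealCLM (φ z)) y v‖ ^ 2) =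
      ∫ y, ‖fderiv ℝ φ y v‖ ^ 2 := by
    intro v; simp_rw [hd1 v]; simp
  have e2 : ∀ u v : E, (∫ y, ‖fderiv ℝ (fun z => fderiv ℝ (fun z' => Complex.ofRealCLM (φ z')) z v) y u‖ ^ 2) =
      ∫ y, ‖fderiv ℝ (fun z => fderiv ℝ φ z v) y u‖ ^ 2 := by
    intro u v; simp_rw [hd2 u v]; simp
  simp_rw [e0, e1, e2] at h
  exact h

/-- **Agmon's inequality with the explicit constant `√2/π`, vector fields, weak hypotheses**: for
`v : E → F` of class `C^∞` with every derivative in `L²` (`F` a real inner product space, `E` three-dimensional),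
`‖v(x)‖ ≤ (√2/π) · (∑ᵢ ‖∂ᵢv‖₂²)^{1/4} · (∑ᵢⱼ ‖∂ᵢ∂ⱼv‖₂²)^{1/4}` (g6's `norm_le_agmon_explicit` without the
boundedness half of `IsSmoothL2Field`; test against `v(x)/‖v(x)‖`). [cite: SteinWeiss1971, Ch. I Thm. 2.3] -/
theorem norm_le_agmon_explicit' (h3 : Module.finrank ℝ E = 3) {F : Type*} [NormedAddCommGroup F]
    [InnerProductSpace ℝ F] {v : E → F} (hv : ContDiff ℝ ∞ v)
    (hn : ∀ n : ℕ, ∫⁻ x, ‖iteratedFDeriv ℝ n v x‖ₑ ^ 2 < ⊤) (x : E) :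
    ‖v x‖ ≤ Real.sqrt 2 / Real.pi *
      Real.sqrt (Real.sqrt (∑ i, ∫ y, ‖fderiv ℝ v y (stdOrthonormalBasis ℝ E i)‖ ^ 2) *
        Real.sqrt (∑ i, ∑ j, ∫ y, ‖fderiv ℝ (fun z => fderiv ℝ v z (stdOrthonormalBasis ℝ E j)) y
          (stdOrthonormalBasis ℝ E i)‖ ^ 2)) := by
  by_cases hx : v x = 0
  · rw [hx, norm_zero]; positivity
  -- the unit vector along `v x` and the scalar field `φ = ⟪e, v⟫`
  set e : F := ‖v x‖⁻¹ • v x with he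
  have hxn : 0 < ‖v x‖ := norm_pos_iff.2 hx
  have he1 : ‖e‖ = 1 := by
    rw [he, norm_smul, norm_inv, norm_norm, inv_mul_cancel₀ hxn.ne']
  have hφc : ContDiff ℝ ∞ (fun y => (innerSL ℝ e) (v y)) := (innerSL ℝ e).contDiff.comp hv
  have h := norm_le_agmon_explicit_real' h3 hφc (sobolev_clm_comp hv hn (innerSL ℝ e)) x
  have hvd : Differentiable ℝ v := hv.differentiable (by simp)
  have hφx : (innerSL ℝ e) (v x) = ‖v x‖ := by
    simp only [innerSL_apply_apply, he, real_inner_smul_left, real_inner_self_eq_norm_sq]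
    field_simp
  -- slices of `v` and their regularity
  have hsl : ∀ u : E, ContDiff ℝ ∞ (fun y => fderiv ℝ v y u) := contDiff_fderiv_apply hv
  have hsln : ∀ (u : E) (n : ℕ), ∫⁻ y, ‖iteratedFDeriv ℝ n (fun y => fderiv ℝ v y u) y‖ₑ ^ 2 < ⊤ :=
    sobolev_fderiv_apply hv hn
  -- first and second derivatives of `φ` are the `e`-components of those of `v`
  have hd1 : ∀ (w : E) (y : E), fderiv ℝ (fun z => (innerSL ℝ e) (v z)) y w =
      (innerSL ℝ e) (fderiv ℝ v y w) := fun w y => fderiv_clm_comp_apply (innerSL ℝ e) hvd y w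
  have hd1' : ∀ w : E, (fun y => fderiv ℝ (fun z => (innerSL ℝ e) (v z)) y w) =
      fun y => (innerSL ℝ e) (fderiv ℝ v y w) := fun w => funext (hd1 w)
  have hVd : ∀ w : E, Differentiable ℝ (fun y => fderiv ℝ v y w) := fun w =>
    (hsl w).differentiable (by simp)
  have hd2 : ∀ (u w : E) (y : E), fderiv ℝ (fun z => fderiv ℝ (fun z' => (innerSL ℝ e) (v z')) z w) y u =
      (innerSL ℝ e) (fderiv ℝ (fun z => fderiv ℝ v z w) y u) := by
    intro u w y; rw [hd1' w]; exact fderiv_clm_comp_apply (innerSL ℝ e) (hVd w) y u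
  have hcomp : ∀ z : F, ‖(innerSL ℝ e) z‖ ≤ ‖z‖ := fun z => by
    rw [innerSL_apply_apply]
    exact (abs_real_inner_le_norm e z).trans (by rw [he1, one_mul])
  -- comparison of the Sobolev integrals
  have hG : (∑ i, ∫ y, ‖fderiv ℝ (fun z => (innerSL ℝ e) (v z)) y (stdOrthonormalBasis ℝ E i)‖ ^ 2) ≤
      ∑ i, ∫ y, ‖fderiv ℝ v y (stdOrthonormalBasis ℝ E i)‖ ^ 2 := by
    refine Finset.sum_le_sum fun i _ => ?_
    simp_rw [hd1 (stdOrthonormalBasis ℝ E i)]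
    exact integral_mono
      (integrable_sq_norm_of_sobolev_zero ((innerSL ℝ e).contDiff.comp (hsl _))
        (sobolev_clm_comp (hsl _) (hsln _) (innerSL ℝ e) 0))
      (integrable_sq_norm_of_sobolev_zero (hsl _) (hsln _ 0))
      fun y => pow_le_pow_left₀ (norm_nonneg _) (hcomp _) 2
  have hH : (∑ i, ∑ j, ∫ y, ‖fderiv ℝ (fun z => fderiv ℝ (fun z' => (innerSL ℝ e) (v z')) z
      (stdOrthonormalBasis ℝ E j)) y (stdOrthonormalBasis ℝ E i)‖ ^ 2) ≤
      ∑ i, ∑ j, ∫ y, ‖fderiv ℝ (fun z => fderiv ℝ v z (stdOrthonormalBasis ℝ E j)) y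
        (stdOrthonormalBasis ℝ E i)‖ ^ 2 := by
    refine Finset.sum_le_sum fun i _ => Finset.sum_le_sum fun j _ => ?_
    simp_rw [hd2 (stdOrthonormalBasis ℝ E i) (stdOrthonormalBasis ℝ E j)]
    have hsl2 : ContDiff ℝ ∞ (fun y => fderiv ℝ (fun z => fderiv ℝ v z (stdOrthonormalBasis ℝ E j)) y
        (stdOrthonormalBasis ℝ E i)) := contDiff_fderiv_apply (hsl _) _
    have hsl2n : ∀ n : ℕ, ∫⁻ y, ‖iteratedFDeriv ℝ n (fun y => fderiv ℝ (fun z => fderiv ℝ v z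
        (stdOrthonormalBasis ℝ E j)) y (stdOrthonormalBasis ℝ E i)) y‖ₑ ^ 2 < ⊤ :=
      sobolev_fderiv_apply (hsl _) (hsln _) _
    exact integral_mono
      (integrable_sq_norm_of_sobolev_zero ((innerSL ℝ e).contDiff.comp hsl2)
        (sobolev_clm_comp hsl2 hsl2n (innerSL ℝ e) 0))
      (integrable_sq_norm_of_sobolev_zero hsl2 (hsl2n 0))
      fun y => pow_le_pow_left₀ (norm_nonneg _) (hcomp _) 2
  rw [hφx, Real.norm_of_nonneg hxn.le] at h
  refine h.trans ?_
  have hπ : 0 < Real.pi := Real.pi_pos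
  gcongr

/-! ## §3 On `ℝ³`, in the quantities `∫|∇w|²_F` and `∫‖Δw‖²` -/

/-- **Basis independence of the second-order sum**: for a `C^∞` field `w` on `ℝ³`,
`∑ᵢⱼ ‖D(Dw·bⱼ)(y)·bᵢ‖²` over the standard ORTHONORMAL basis `b = stdOrthonormalBasis` equals the tree's
coordinate tensor norm `levelSq 2 w y` (the same sum over `EuclideanSpace.basisFun`): both are
`∑ᵢⱼ‖D²w(y)(bᵢ)(bⱼ)‖²`, and `∑ᵢ |T bᵢ|²_F`, `∑ₖ |Tᶠˡⁱᵖ eₖ|²_F` are basis-free Frobenius sums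
(`frobeniusNormSq_eq_sum`; no symmetry of `D²w` is used). [cite: RobinsonRodrigoSadowski2016, Thm. 1.20] -/
theorem sum_sum_norm_fderiv_fderiv_eq_levelSq_two
    {w : EuclideanSpace ℝ (Fin 3) → EuclideanSpace ℝ (Fin 3)} (hw : ContDiff ℝ ∞ w)
    (y : EuclideanSpace ℝ (Fin 3)) :
    (∑ i, ∑ j, ‖fderiv ℝ (fun z => fderiv ℝ w z (stdOrthonormalBasis ℝ (EuclideanSpace ℝ (Fin 3)) j)) y
        (stdOrthonormalBasis ℝ (EuclideanSpace ℝ (Fin 3)) i)‖ ^ 2) = levelSq 2 w y := by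
  set b := stdOrthonormalBasis ℝ (EuclideanSpace ℝ (Fin 3)) with hb
  set e := EuclideanSpace.basisFun (Fin 3) ℝ with he
  set T := fderiv ℝ (fderiv ℝ w) y with hT
  have hd : Differentiable ℝ (fderiv ℝ w) := (hw.fderiv_right (m := ∞) (by simp)).differentiable (by simp)
  have key : ∀ u u' : EuclideanSpace ℝ (Fin 3), fderiv ℝ (fun z => fderiv ℝ w z u') y u = T u u' := by
    intro u u'
    rw [hT, fderiv_clm_apply (hd y) (differentiableAt_const u')]
    simp
  rw [levelSq_two_eq_sum_sum hw y]
  simp_rw [key]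
  have A : ∀ i, (∑ j, ‖T (b i) (b j)‖ ^ 2) = ∑ k, ‖T (b i) (e k)‖ ^ 2 := fun i => by
    rw [← frobeniusNormSq_eq_sum b (T (b i)), frobeniusNormSq_eq_sum e]
  have B : ∀ k, (∑ i, ‖T (b i) (e k)‖ ^ 2) = ∑ l, ‖T (e l) (e k)‖ ^ 2 := fun k => by
    have h1 := frobeniusNormSq_eq_sum b (T.flip (e k))
    have h2 := frobeniusNormSq_eq_sum e (T.flip (e k))
    simp only [ContinuousLinearMap.flip_apply] at h1 h2
    rw [← h1, h2]
  calc (∑ i, ∑ j, ‖T (b i) (b j)‖ ^ 2) = ∑ i, ∑ k, ‖T (b i) (e k)‖ ^ 2 :=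
        Finset.sum_congr rfl fun i _ => A i
    _ = ∑ k, ∑ i, ‖T (b i) (e k)‖ ^ 2 := Finset.sum_comm
    _ = ∑ k, ∑ l, ‖T (e l) (e k)‖ ^ 2 := Finset.sum_congr rfl fun k _ => B k

/-- **Agmon's inequality on `ℝ³` with the explicit constant `√2/π` in the quantities `∫|∇w|²_F`, `∫‖Δw‖²`**
(RRS 2016, Thm 1.20, with the constant of the Fourier proof): for a `C^∞` field `w : ℝ³ → ℝ³` with every
derivative in `L²`, `‖w(x)‖ ≤ (√2/π) (∫|∇w|²_F · ∫‖Δw‖²)^{1/4}` — the literal twin of the tree's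
`norm_le_agmonConst_mul_rpow` with `agmonConst ↦ √2/π` (`levelSq 1 = |∇·|²_F` via `frobeniusNormSq_eq_sum`,
the Hessian–Laplacian identity `∫ levelSq 2 = ∫‖Δ·‖²` of `integral_levelSq_two_eq_integral_laplacian_sq`, and
`√(√X√Y) = (XY)^{1/4}`). [cite: RobinsonRodrigoSadowski2016, Thm. 1.20] [cite: SteinWeiss1971, Ch. I Thm. 2.3] -/
theorem norm_le_explicitAgmon_mul_rpow {w : EuclideanSpace ℝ (Fin 3) → EuclideanSpace ℝ (Fin 3)}
    (hw : ContDiff ℝ ∞ w) (hn : ∀ n : ℕ, ∫⁻ x, ‖iteratedFDeriv ℝ n w x‖ₑ ^ 2 < ⊤)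
    (x : EuclideanSpace ℝ (Fin 3)) :
    ‖w x‖ ≤ Real.sqrt 2 / Real.pi *
      ((∫ y, frobeniusNormSq (fderiv ℝ w y)) * ∫ y, ‖(Δ w) y‖ ^ 2) ^ (1 / 4 : ℝ) := by
  have h := norm_le_agmon_explicit' (E := EuclideanSpace ℝ (Fin 3)) finrank_euclideanSpace_fin hw hn x
  have hsl : ∀ u, ContDiff ℝ ∞ (fun y => fderiv ℝ w y u) := contDiff_fderiv_apply hw
  have hsln : ∀ (u : EuclideanSpace ℝ (Fin 3)) (n : ℕ),
      ∫⁻ y, ‖iteratedFDeriv ℝ n (fun y => fderiv ℝ w y u) y‖ₑ ^ 2 < ⊤ := sobolev_fderiv_apply hw hn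
  -- first-order sum = `∫|∇w|²_F`
  have e1 : (∑ i, ∫ y, ‖fderiv ℝ w y (stdOrthonormalBasis ℝ (EuclideanSpace ℝ (Fin 3)) i)‖ ^ 2) =
      ∫ y, frobeniusNormSq (fderiv ℝ w y) := by
    rw [← integral_finsetSum _ (fun i _ => integrable_sq_norm_of_sobolev_zero (hsl _) (hsln _ 0))]
    rfl
  -- second-order sum = `∫‖Δw‖²`
  have e2 : (∑ i, ∑ j, ∫ y, ‖fderiv ℝ (fun z => fderiv ℝ w z
      (stdOrthonormalBasis ℝ (EuclideanSpace ℝ (Fin 3)) j)) y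
        (stdOrthonormalBasis ℝ (EuclideanSpace ℝ (Fin 3)) i)‖ ^ 2) = ∫ y, ‖(Δ w) y‖ ^ 2 := by
    rw [← integral_levelSq_two_eq_integral_laplacian_sq (hw.of_le (by norm_cast)) (hn 1) (hn 2) (hn 3)]
    have hi2 : ∀ i j, Integrable (fun y => ‖fderiv ℝ (fun z => fderiv ℝ w z
        (stdOrthonormalBasis ℝ (EuclideanSpace ℝ (Fin 3)) j)) y
          (stdOrthonormalBasis ℝ (EuclideanSpace ℝ (Fin 3)) i)‖ ^ 2) := fun i j =>
      integrable_sq_norm_of_sobolev_zero (contDiff_fderiv_apply (hsl _) _)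
        (sobolev_fderiv_apply (hsl _) (hsln _) _ 0)
    have hin : ∀ i, (∑ j, ∫ y, ‖fderiv ℝ (fun z => fderiv ℝ w z
        (stdOrthonormalBasis ℝ (EuclideanSpace ℝ (Fin 3)) j)) y
          (stdOrthonormalBasis ℝ (EuclideanSpace ℝ (Fin 3)) i)‖ ^ 2) =
        ∫ y, ∑ j, ‖fderiv ℝ (fun z => fderiv ℝ w z
          (stdOrthonormalBasis ℝ (EuclideanSpace ℝ (Fin 3)) j)) y
            (stdOrthonormalBasis ℝ (EuclideanSpace ℝ (Fin 3)) i)‖ ^ 2 := fun i =>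
      (integral_finsetSum _ (fun j _ => hi2 i j)).symm
    simp_rw [hin]
    rw [← integral_finsetSum _ (fun i _ => integrable_finsetSum _ fun j _ => hi2 i j)]
    exact integral_congr_ae (Eventually.of_forall fun y => sum_sum_norm_fderiv_fderiv_eq_levelSq_two hw y)
  have hX0 : 0 ≤ ∫ y, frobeniusNormSq (fderiv ℝ w y) := integral_nonneg fun _ => frobeniusNormSq_nonneg _
  have hY0 : 0 ≤ ∫ y, ‖(Δ w) y‖ ^ 2 := integral_nonneg fun _ => sq_nonneg _
  have hconv : Real.sqrt (Real.sqrt (∫ y, frobeniusNormSq (fderiv ℝ w y)) * Real.sqrt (∫ y, ‖(Δ w) y‖ ^ 2)) =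
      ((∫ y, frobeniusNormSq (fderiv ℝ w y)) * ∫ y, ‖(Δ w) y‖ ^ 2) ^ (1 / 4 : ℝ) := by
    rw [← Real.sqrt_mul hX0, Real.sqrt_eq_rpow, Real.sqrt_eq_rpow, ← Real.rpow_mul (mul_nonneg hX0 hY0)]
    norm_num
  rw [e1, e2, hconv] at h
  exact h

end Summit.NavierStokesRegularity.NavierStokesRegularity.Theorems.AgmonExplicitSobolev

end
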